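import Summits.SmoothPoincare4.SmoothPoincare4.Theorems.SullivanDualTargetOfSympcap
import Summits.SmoothPoincare4.SmoothPoincare4.Theorems.SullivanDualWitnessChargeHelperEndHolomorphic
import Literature.Geometry.Symplectic.JHolomorphicOn
import Mathlib.Analysis.Complex.AbsMax
import Mathlib.Analysis.Normed.Lp.ProdLp

/-!
# Maximum principle for the Euclidean norm of a holomorphic map into `ℂ²`
(line `last-twisted-circle`, crux stmt-SmoothPoincare4-7823, helper `helper_ltcMaxPrinciple` of
`stub_endConfinement`)

If `Ω ⊆ ℂ` is a bounded open set, `Y : ℂ → ℂ × ℂ` is complex differentiable on `Ω` and continuous on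
`closure Ω`, the Euclidean norm `‖realify (Y z)‖` is `≤ M` on `frontier Ω` and `> M` at every point
of `Ω`, then `Ω = ∅`.

Proof: transport `Y` to the genuinely normed target `WithLp 2 (ℂ × ℂ)` (whose norm is the Euclidean
norm, i.e. `‖realify ·‖`, by `WithLp.prod_norm_sq_eq_of_L2` and `norm_realify_sq`) and apply
Mathlib's maximum modulus principle `Complex.norm_le_of_forall_mem_frontier_norm_le`: on a bounded
set the frontier bound propagates to the closure, contradicting the strict interior inequality at any
point of `Ω`.
-/

noncomputable section

set_option linter.dupNamespace false

open scoped Manifold ContDiff Topology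
open Set Filter MeasureTheory Literature.Geometry.Kaehler Literature.Geometry.Symplectic
  Literature.Topology.FourManifolds
open Summit.SmoothPoincare4.SmoothPoincare4.Theorems.WitnessCharge.PencilIncompleteness

namespace Summit.SmoothPoincare4.SmoothPoincare4.Theorems.Target.LastTwistedCircle

/-- The `L²` product norm of `q ∈ ℂ × ℂ` (transported to `WithLp 2 (ℂ × ℂ)`) is the Euclidean norm
of its realification `realify q ∈ ℝ⁴`. [folklore] -/
theorem norm_toLp_two_eq_norm_realify (q : ℂ × ℂ) :
    ‖WithLp.toLp 2 q‖ = ‖realify q‖ := by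
  have h1 : ‖WithLp.toLp 2 q‖ ^ 2 = ‖q.1‖ ^ 2 + ‖q.2‖ ^ 2 := by
    rw [WithLp.prod_norm_sq_eq_of_L2]
    rfl
  have h2 := norm_realify_sq q
  exact (sq_eq_sq₀ (norm_nonneg _) (norm_nonneg _)).mp (h1.trans h2.symm)

/-- MAXIMUM PRINCIPLE for the Euclidean norm of a holomorphic map `Y : Ω → ℂ²` on a bounded open
`Ω ⊆ ℂ`, continuous up to the closure: if `‖Y‖₂ ≤ M` on the frontier and `‖Y‖₂ > M` at every point
of `Ω`, then `Ω` is empty. [folklore] -/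
theorem helper_ltcMaxPrinciple :
    ∀ (Ω : Set ℂ) (Y : ℂ → ℂ × ℂ) (M R : ℝ), IsOpen Ω → Ω ⊆ Metric.closedBall (0 : ℂ) R →
      DifferentiableOn ℂ Y Ω → ContinuousOn Y (closure Ω) →
      (∀ z ∈ frontier Ω, ‖realify (Y z)‖ ≤ M) → (∀ z ∈ Ω, M < ‖realify (Y z)‖) → Ω = ∅ := by
  intro Ω Y M R _hΩ hΩR hYd hYc hfr hint
  -- transport to the normed target `WithLp 2 (ℂ × ℂ)`
  set T : ℂ × ℂ →L[ℂ] WithLp 2 (ℂ × ℂ) :=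
    ((WithLp.prodContinuousLinearEquiv 2 ℂ ℂ ℂ).symm : ℂ × ℂ →L[ℂ] WithLp 2 (ℂ × ℂ)) with hT
  have hTapply : ∀ q : ℂ × ℂ, T q = WithLp.toLp 2 q := fun q => rfl
  have hnorm : ∀ q : ℂ × ℂ, ‖T q‖ = ‖realify q‖ := fun q => by
    rw [hTapply, norm_toLp_two_eq_norm_realify]
  set g : ℂ → WithLp 2 (ℂ × ℂ) := fun z => T (Y z) with hg
  have hd : DiffContOnCl ℂ g Ω :=
    ⟨T.differentiable.comp_differentiableOn hYd, T.continuous.comp_continuousOn hYc⟩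
  have hB : Bornology.IsBounded Ω := Metric.isBounded_closedBall.subset hΩR
  rcases Set.eq_empty_or_nonempty Ω with h | ⟨z, hz⟩
  · exact h
  · exfalso
    have h1 : ‖g z‖ ≤ M :=
      Complex.norm_le_of_forall_mem_frontier_norm_le hB hd
        (fun w hw => by rw [hg, hnorm]; exact hfr w hw) (subset_closure hz)
    have h2 : M < ‖g z‖ := by
      rw [hg, hnorm]
      exact hint z hz
    exact absurd h1 (not_le.mpr h2)

end Summit.SmoothPoincare4.SmoothPoincare4.Theorems.Target.LastTwistedCircle

end
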